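import Summits.AtomisticToContinuum.BoseEinsteinCondensation.Theorems.InfraredMinimumUncertainty.Negative.MinimalityLoadBearing

/-!
# Negative lemmas for crux `InfraredMinimumUncertainty` (stmt-AtomisticToContinuum-11784) — XII:
# the near-minimiser / minimality-free frames of the ladder rungs, and the witness scale

Supports (does not close) stmt-AtomisticToContinuum-11784 (picked line `fisher-gaussian-density-mode`; the
V-form statements `DensityMomentDomination`, `FeynmanSaturation`, `FisherDominationV`, `FisherGaussianityV`
of `Theorems/BECConjugateDominationDefs.lean`).  Importable form of §H (part 4 of 6) of the cdisprove seat's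
standing file `Cruxes/InfraredMinimumUncertainty/Disproof.lean` (generation 2).

* `FrameNearMinimisers P` / `FrameWithoutMinimality P`: `CruxFrame P` with the minimiser hypothesis
  `periodicEnergy v Ψ = E₀^per` WEAKENED to `≤ E₀^per + δ` (`δ > 0` chosen before `N`) / DELETED;
  `cruxFrame_of_frameNear` (a strengthening), `frameNear_of_frameWithout`,
  `not_frameNear_of_free_witness` / `not_frameWithout_of_free_witness` (a free-gas witness family kills them);
* the rung bodies `dmdBody`, `fsBody`, `fdVBody`, `fgVBody` with `Iff.rfl` certificates
  `densityMomentDomination_iff`, `feynmanSaturation_iff`, `fisherDominationV_iff`, `fisherGaussianityV_iff`,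
  and the eight weakened statements `…NearMinimisers` / `…WithoutMinimality`;
* `eventually_lt_mul_witnessScale`: `T_N = min(N/16, δL_N²/(16π²)) → ∞` (`C < a·T_N` eventually).
-/

noncomputable section

open MeasureTheory Filter Set
open scoped ENNReal NNReal Topology ComplexConjugate BigOperators

namespace Summit.AtomisticToContinuum.BoseEinsteinCondensation.Theorems.InfraredMinimumUncertainty.Negative

open Literature.MathematicalPhysics.QuantumManyBody.BoseGas
open Summit.AtomisticToContinuum.BoseEinsteinCondensation.Theses.BECConjugateDomination
open Summit.AtomisticToContinuum.BoseEinsteinCondensation.Cruxes.InfraredMinimumUncertainty.FisherGaussianDensityMode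
open Summit.AtomisticToContinuum.BoseEinsteinCondensation.Theorems.GaussianDominationCan.Negative
  (prodFun contDiff_prodFun fderiv_prodFun integral_cellN_prod)
open Summit.AtomisticToContinuum.BoseEinsteinCondensation.Theorems.StaticResponseBound.Negative
  (arg re_cellWave integral_norm_sq_eq_one phiMode argCLM argCLM_apply integral_cell_trig_combo
    phiMode_sq integral_cell_phiMode_sq arg_intSMul isRepulsiveFiniteRange_zero)
open Summit.AtomisticToContinuum.BoseEinsteinCondensation.Theorems.CorrectorClosure.Negative
  (e0 e0_ne_zero sideLength_succ_pos)

/-! ### The two weakened frames -/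

section Frames

/-- The crux frame with the minimiser hypothesis WEAKENED to `periodicEnergy v Ψ ≤ E₀^per + δ` for a
slack `δ > 0` chosen after `ρ` (and `v`, `C`) but BEFORE `N` — everything else verbatim from
`CruxFrame`. -/
def FrameNearMinimisers
    (P : ℝ → ∀ (ρ : ℝ) (n : ℕ), PeriodicTrialState (n + 1) (sideLength ρ (n + 1)) → Prop) : Prop :=
  ∀ v : ℝ → ℝ≥0∞, IsRepulsiveFiniteRange v → (∀ r, v r ≠ ⊤) →
    ContDiff ℝ 2 (fun x : Space => (v ‖x‖).toReal) →
    (∃ Cₑ : ℝ, ∀ x : Space,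
      ‖iteratedFDeriv ℝ 2 (fun x : Space => (v ‖x‖).toReal) x‖ ≤ Cₑ * Real.sqrt ((v ‖x‖).toReal)) →
    ∃ C : ℝ, 0 ≤ C ∧ ∃ ρ₀ : ℝ, 0 < ρ₀ ∧ ∀ ρ : ℝ, 0 < ρ → ρ < ρ₀ → ∃ δ : ℝ, 0 < δ ∧
      ∀ᶠ n : ℕ in atTop, ∀ Ψ : PeriodicTrialState (n + 1) (sideLength ρ (n + 1)),
        periodicEnergy v Ψ ≤ periodicGroundStateEnergy v (n + 1) (sideLength ρ (n + 1)) +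
            ENNReal.ofReal δ →
        periodicEnergy v Ψ ≠ ⊤ → (∀ X, Ψ.ψ X = (‖Ψ.ψ X‖ : ℂ)) → (∀ X, Ψ.ψ X ≠ 0) → P C ρ n Ψ

/-- The crux frame with the minimiser hypothesis DELETED (finite energy, `Ψ = |Ψ| ≠ 0` kept). -/
def FrameWithoutMinimality
    (P : ℝ → ∀ (ρ : ℝ) (n : ℕ), PeriodicTrialState (n + 1) (sideLength ρ (n + 1)) → Prop) : Prop :=
  ∀ v : ℝ → ℝ≥0∞, IsRepulsiveFiniteRange v → (∀ r, v r ≠ ⊤) →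
    ContDiff ℝ 2 (fun x : Space => (v ‖x‖).toReal) →
    (∃ Cₑ : ℝ, ∀ x : Space,
      ‖iteratedFDeriv ℝ 2 (fun x : Space => (v ‖x‖).toReal) x‖ ≤ Cₑ * Real.sqrt ((v ‖x‖).toReal)) →
    ∃ C : ℝ, 0 ≤ C ∧ ∃ ρ₀ : ℝ, 0 < ρ₀ ∧ ∀ ρ : ℝ, 0 < ρ → ρ < ρ₀ →
      ∀ᶠ n : ℕ in atTop, ∀ Ψ : PeriodicTrialState (n + 1) (sideLength ρ (n + 1)),
        periodicEnergy v Ψ ≠ ⊤ → (∀ X, Ψ.ψ X = (‖Ψ.ψ X‖ : ℂ)) → (∀ X, Ψ.ψ X ≠ 0) → P C ρ n Ψ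

variable {P : ℝ → ∀ (ρ : ℝ) (n : ℕ), PeriodicTrialState (n + 1) (sideLength ρ (n + 1)) → Prop}

/-- The near-minimiser frame is a STRENGTHENING of the crux frame (a minimiser is a
`δ`-near-minimiser). [folklore] -/
theorem cruxFrame_of_frameNear (h : FrameNearMinimisers P) : CruxFrame P := by
  intro v h₁ h₂ h₃ h₄
  obtain ⟨C, hC, ρ₀, hρ₀, hB⟩ := h v h₁ h₂ h₃ h₄
  refine ⟨C, hC, ρ₀, hρ₀, fun ρ hρ hρρ₀ => ?_⟩
  obtain ⟨δ, _hδ, hev⟩ := hB ρ hρ hρρ₀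
  filter_upwards [hev] with n hn Ψ hE hfin hreal hpos
  exact hn Ψ (le_of_eq_of_le hE le_self_add) hfin hreal hpos

/-- The minimality-free frame implies the near-minimiser frame. [folklore] -/
theorem frameNear_of_frameWithout (h : FrameWithoutMinimality P) : FrameNearMinimisers P := by
  intro v h₁ h₂ h₃ h₄
  obtain ⟨C, hC, ρ₀, hρ₀, hB⟩ := h v h₁ h₂ h₃ h₄
  refine ⟨C, hC, ρ₀, hρ₀, fun ρ hρ hρρ₀ => ⟨1, one_pos, ?_⟩⟩
  filter_upwards [hB ρ hρ hρρ₀] with n hn Ψ _hE hfin hreal hpos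
  exact hn Ψ hfin hreal hpos

/-- **A free-gas witness family kills the near-minimiser frame.**  If at `v ≡ 0`, for every `ρ > 0`,
`δ > 0` and `C ≥ 0`, eventually in `N` there is a positive real admissible `Ψ` of energy `≤ δ`
violating `P C ρ n Ψ`, then `FrameNearMinimisers P` is false. [folklore] -/
theorem not_frameNear_of_free_witness
    (hW : ∀ ρ : ℝ, 0 < ρ → ∀ δ : ℝ, 0 < δ → ∀ C : ℝ, 0 ≤ C → ∀ᶠ n : ℕ in atTop,
      ∃ Ψ : PeriodicTrialState (n + 1) (sideLength ρ (n + 1)),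
        periodicEnergy 0 Ψ ≤ ENNReal.ofReal δ ∧ (∀ X, Ψ.ψ X = (‖Ψ.ψ X‖ : ℂ)) ∧ (∀ X, Ψ.ψ X ≠ 0) ∧
          ¬ P C ρ n Ψ) :
    ¬ FrameNearMinimisers P := by
  intro h
  obtain ⟨h₁, h₂, h₃, h₄⟩ := inSmoothClass_zero
  obtain ⟨C, hC, ρ₀, hρ₀, hB⟩ := h 0 h₁ h₂ h₃ h₄
  have hρ : (0 : ℝ) < ρ₀ / 2 := by positivity
  obtain ⟨δ, hδ, hev⟩ := hB (ρ₀ / 2) hρ (by linarith)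
  obtain ⟨n, hn, Ψ, hEδ, hreal, hpos, hP⟩ := (hev.and (hW (ρ₀ / 2) hρ δ hδ C hC)).exists
  have hfin : periodicEnergy 0 Ψ ≠ ⊤ := ne_top_of_le_ne_top ENNReal.ofReal_ne_top hEδ
  exact hP (hn Ψ (hEδ.trans le_add_self) hfin hreal hpos)

/-- Corollary for the minimality-free frame. [folklore] -/
theorem not_frameWithout_of_free_witness
    (hW : ∀ ρ : ℝ, 0 < ρ → ∀ δ : ℝ, 0 < δ → ∀ C : ℝ, 0 ≤ C → ∀ᶠ n : ℕ in atTop,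
      ∃ Ψ : PeriodicTrialState (n + 1) (sideLength ρ (n + 1)),
        periodicEnergy 0 Ψ ≤ ENNReal.ofReal δ ∧ (∀ X, Ψ.ψ X = (‖Ψ.ψ X‖ : ℂ)) ∧ (∀ X, Ψ.ψ X ≠ 0) ∧
          ¬ P C ρ n Ψ) :
    ¬ FrameWithoutMinimality P := fun h =>
  not_frameNear_of_free_witness hW (frameNear_of_frameWithout h)

end Frames

/-! ### The four rung bodies (verbatim the lambda bodies of the Defs statements) -/

section Bodies

/-- DMD body: `4 N² ‖k‖⁴ ν_m ≤ C · m₂` for all `m ≠ 0`. -/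
def dmdBody (C ρ : ℝ) (n : ℕ) (Ψ : PeriodicTrialState (n + 1) (sideLength ρ (n + 1))) : Prop :=
  ∀ m : Fin 3 → ℤ, m ≠ 0 →
    4 * ((n : ℝ) + 1) ^ 2 * ‖waveVec (sideLength ρ (n + 1)) m‖ ^ 4 *
        levyWeight n (sideLength ρ (n + 1)) Ψ m ≤
      C * secondMoment (n + 1) (sideLength ρ (n + 1)) Ψ.ψ m

/-- FS body: `(N S_m) · m₂ ≤ C · N² ‖k‖⁴` for all `m ≠ 0`. -/
def fsBody (C ρ : ℝ) (n : ℕ) (Ψ : PeriodicTrialState (n + 1) (sideLength ρ (n + 1))) : Prop :=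
  ∀ m : Fin 3 → ℤ, m ≠ 0 →
    (((n : ℝ) + 1) * structureFactor n (sideLength ρ (n + 1)) Ψ m) *
        secondMoment (n + 1) (sideLength ρ (n + 1)) Ψ.ψ m ≤
      C * (((n : ℝ) + 1) ^ 2 * ‖waveVec (sideLength ρ (n + 1)) m‖ ^ 4)

/-- FD-V body: `∃ φ continuous, 16 ν_m ≤ C · J^V_m(φ)` for all `m ≠ 0`. -/
def fdVBody (C ρ : ℝ) (n : ℕ) (Ψ : PeriodicTrialState (n + 1) (sideLength ρ (n + 1))) : Prop :=
  ∀ m : Fin 3 → ℤ, m ≠ 0 → ∃ φ : ℂ → ℂ, Continuous φ ∧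
    16 * levyWeight n (sideLength ρ (n + 1)) Ψ m ≤ C * fisherTestV n (sideLength ρ (n + 1)) Ψ m φ

/-- FG-V body: `∀ φ continuous, J^V_m(φ) · (N S_m) ≤ C` for all `m ≠ 0`. -/
def fgVBody (C ρ : ℝ) (n : ℕ) (Ψ : PeriodicTrialState (n + 1) (sideLength ρ (n + 1))) : Prop :=
  ∀ m : Fin 3 → ℤ, m ≠ 0 → ∀ φ : ℂ → ℂ, Continuous φ →
    fisherTestV n (sideLength ρ (n + 1)) Ψ m φ *
      (((n : ℝ) + 1) * structureFactor n (sideLength ρ (n + 1)) Ψ m) ≤ C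

/-- Certificate: `DensityMomentDomination` IS `CruxFrame dmdBody`. -/
theorem densityMomentDomination_iff : DensityMomentDomination ↔ CruxFrame dmdBody := Iff.rfl

/-- Certificate: `FeynmanSaturation` IS `CruxFrame fsBody`. -/
theorem feynmanSaturation_iff : FeynmanSaturation ↔ CruxFrame fsBody := Iff.rfl

/-- Certificate: `FisherDominationV` IS `CruxFrame fdVBody`. -/
theorem fisherDominationV_iff : FisherDominationV ↔ CruxFrame fdVBody := Iff.rfl

/-- Certificate: `FisherGaussianityV` IS `CruxFrame fgVBody`. -/
theorem fisherGaussianityV_iff : FisherGaussianityV ↔ CruxFrame fgVBody := Iff.rfl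

/-- DMD with minimality weakened to `δ`-near-minimality (`δ` before `N`). -/
def DensityMomentDominationNearMinimisers : Prop := FrameNearMinimisers dmdBody
/-- DMD with the minimiser hypothesis deleted. -/
def DensityMomentDominationWithoutMinimality : Prop := FrameWithoutMinimality dmdBody
/-- FS with minimality weakened to `δ`-near-minimality. -/
def FeynmanSaturationNearMinimisers : Prop := FrameNearMinimisers fsBody
/-- FS with the minimiser hypothesis deleted. -/
def FeynmanSaturationWithoutMinimality : Prop := FrameWithoutMinimality fsBody
/-- FD-V with minimality weakened to `δ`-near-minimality. -/
def FisherDominationVNearMinimisers : Prop := FrameNearMinimisers fdVBody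
/-- FD-V with the minimiser hypothesis deleted. -/
def FisherDominationVWithoutMinimality : Prop := FrameWithoutMinimality fdVBody
/-- FG-V with minimality weakened to `δ`-near-minimality. -/
def FisherGaussianityVNearMinimisers : Prop := FrameNearMinimisers fgVBody
/-- FG-V with the minimiser hypothesis deleted. -/
def FisherGaussianityVWithoutMinimality : Prop := FrameWithoutMinimality fgVBody

end Bodies

/-! ### Growth of the witness scale `T_N = min(N/16, δL²/(16π²))` -/

section Growth

/-- `T_N := min(N/16, δ L_N²/(16π²)) → ∞`: for every `a > 0` and `C`, eventually `C < a · T_N`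
(`L_N³ = N/ρ`). [folklore] -/
theorem eventually_lt_mul_witnessScale {ρ : ℝ} (hρ : 0 < ρ) {δ : ℝ} (hδ : 0 < δ) {a : ℝ} (ha : 0 < a)
    (C : ℝ) :
    ∀ᶠ n : ℕ in atTop, C < a * min (((n : ℝ) + 1) / 16)
      (δ * sideLength ρ (n + 1) ^ 2 / (16 * Real.pi ^ 2)) := by
  set C' : ℝ := max C 0 + 1 with hC'
  have hC'0 : 0 < C' := by have := le_max_right C 0; rw [hC']; linarith
  have hCC' : C < C' := by have := le_max_left C 0; rw [hC']; linarith
  set M : ℝ := max 1 (16 * Real.pi ^ 2 * C' / (a * δ)) with hM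
  have hM1 : 1 ≤ M := le_max_left _ _
  have h1 : ∀ᶠ n : ℕ in atTop, 16 * C' / a < (n : ℝ) :=
    tendsto_natCast_atTop_atTop.eventually_gt_atTop _
  have h2 : ∀ᶠ n : ℕ in atTop, ρ * M ^ 3 < (n : ℝ) :=
    tendsto_natCast_atTop_atTop.eventually_gt_atTop _
  filter_upwards [h1, h2] with n hn1 hn2
  have hL3 := sideLength_succ_pow_three hρ n
  set L := sideLength ρ (n + 1) with hLdef
  have hL : 0 < L := sideLength_succ_pos hρ n
  have hLM : M < L := by
    refine lt_of_pow_lt_pow_left₀ 3 hL.le ?_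
    rw [hL3, lt_div_iff₀ hρ]
    have hM0 : 0 ≤ M ^ 3 := by positivity
    nlinarith
  have hL1 : 1 ≤ L := hM1.trans hLM.le
  refine hCC'.trans_le ?_
  rw [mul_min_of_nonneg _ _ ha.le]
  refine le_min ?_ ?_
  · rw [div_lt_iff₀ ha] at hn1
    have : (n : ℝ) ≤ (n : ℝ) + 1 := by linarith
    nlinarith
  · have hKM : 16 * Real.pi ^ 2 * C' / (a * δ) ≤ M := le_max_right _ _
    rw [div_le_iff₀ (by positivity)] at hKM
    have hLL : L ≤ L ^ 2 := by nlinarith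
    have hpi : 0 < 16 * Real.pi ^ 2 := by positivity
    rw [mul_div_assoc', le_div_iff₀ hpi]
    calc C' * (16 * Real.pi ^ 2) = 16 * Real.pi ^ 2 * C' := by ring
      _ ≤ M * (a * δ) := hKM
      _ ≤ L * (a * δ) := by nlinarith [hLM.le, mul_pos ha hδ]
      _ ≤ L ^ 2 * (a * δ) := by nlinarith [mul_pos ha hδ]
      _ = a * (δ * L ^ 2) := by ring

end Growth

end Summit.AtomisticToContinuum.BoseEinsteinCondensation.Theorems.InfraredMinimumUncertainty.Negative

end
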